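import Literature.Geometry.Riemannian.RicciDeTurckChartNormSq
import HarnessLib

/-!
# The maximum-point estimate `∂ₜ|g₁ - g₂|² ≤ C |g₁ - g₂|²` for two Ricci–DeTurck flows
(topic `Geometry/Riemannian`)

Eleventh layer of the DeTurck decomposition of the named fact
`Literature.Geometry.Riemannian.ricciFlow_uniqueness` (`RicciFlow.lean`; Hamilton 1982,
Thm. 5.1; Topping 2006, Thm. 5.2.2), towards uniqueness of the Ricci–DeTurck flow on a closed
manifold (hypothesis (RU) of `RicciDeTurckReduction.lean`; Andrews–Hopper 2011, §5.4.2,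
Step 1: "standard theory" of strictly parabolic systems) by the maximum principle applied to
`u = |g₁ - g₂|²_h`. This file proves the ANALYTIC HEART of that standard theory in the present
setting: for two families `k₁, k₂` of metrics, `C^∞` on `M × [0, δ]`, read in a chart at `z`,
and a compact subset `K` of the chart target, there is a constant `C` such that at every time
`t ∈ [0, δ]` and every local (spatial) maximum `y₀ ∈ K` of
`û_t = |G¹_t - G²_t|²_h` (`chartNormSq`), the pairing `2⟨∂ₜ(G¹ - G²), G¹ - G²⟩_h` — with
`∂ₜ(G¹ - G²)` GIVEN BY the difference of the right-hand sides of the coordinate Ricci–DeTurck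
equations (`chartDot`) — is at most `C û_t(y₀)` (`exists_maxPoint_const`). The inequality is the
algebraic estimate `JetEstimate.two_mul_ip_le` (`RicciDeTurckJetEstimate.lean`) fed with: the
sign `g₁ᵖ𐞥∂ₚ∂_q û ≤ 0` at the maximum, the Leibniz expansion of `∂ₚ∂_q û`, the decomposition of
`∂ₜ(G¹ - G²)` into principal part, difference of inverse metrics and lower-order remainder
(`normSqCoord_chartDot_eq`), the local Lipschitz bound for the lower-order term
(`exists_lipschitz_rdtLower`), and constants obtained by continuity and compactness on
`K × [0, δ]`. Everything is proved; no named fact and no `sorry` is introduced.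

## Contents (all proved)

* `basisSum`, `basisSum4`, `coordSum`, `coordSum2` — basis constants.
* `wsum_hessian_decomposition` — `∂ₚ∂_q ⟨H, H⟩ = 2⟨∂ₚ∂_qH, H⟩ + 2⟨∂ₚH, ∂_qH⟩ + rem` with
  `|rem| ≤ K₂ ‖H‖² + K₁ ‖H‖ (‖∂ₚH‖ + ‖∂_qH‖)` (`fderiv_fderiv_wsum_apply` and `abs_wsum_le`).
* `abs_normSqCoord_bilinOfCoeffs_le` — `|⟨B(f), T⟩| ≤ K₀ D Nc ‖T‖` for a form with components
  `|f c i| ≤ D`.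
* `fderiv_sub_chartRep`, `fderiv_fderiv_sub_chartRep`, `chartLower_basis_eq`,
  **`normSqCoord_chartDot_eq`** — `⟨∂ₜH, T⟩ = ⟨g₁ᵖ𐞥∂ₚ∂_qH, T⟩ + ⟨(g₁ - g₂)ᵖ𐞥∂ₚ∂_qG², T⟩ + ⟨B(F₁ - F₂), T⟩`.
* **`exists_maxPoint_const`** — the maximum-point estimate with a constant uniform on
  `K × [0, δ]` (Andrews–Hopper 2011, §5.4.2, Step 1; Topping 2006, §5.2 with §3.1).

## References

* B. Andrews, C. Hopper, *The Ricci flow in Riemannian geometry*, LNM 2011 (2011), §5.4.1–§5.4.2,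
  (5.10), Step 1. [AndrewsHopper2011]
* P. Topping, *Lectures on the Ricci flow*, LMS LNS 325 (2006), §3.1 (proof of Thm. 3.1.1), §5.2.
  [Topping2006]
-/

noncomputable section

set_option maxSynthPendingDepth 3

open Bundle Set Function Filter FiberBundle VectorField ContinuousLinearMap TopologicalSpace Metric
open scoped Manifold ContDiff Topology

namespace Literature.Geometry.Riemannian

open Lorentzian Lorentzian.OpensChart Lorentzian.PseudoRiemannianMetric
open Literature.Geometry.Riemannian.OpensChart

/-! ### Basis constants and two generic estimates -/

section Generic

variable {E : Type*} [NormedAddCommGroup E] [NormedSpace ℝ E]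
  {ι : Type*} [Fintype ι] [DecidableEq ι] (b : Module.Basis ι ℝ E)

/-- `∑ₚ ‖bₚ‖`. [folklore] -/
def basisSum : ℝ := ∑ p, ‖b p‖

/-- `∑ ‖b_c‖ ‖bᵢ‖ ‖bₐ‖ ‖bⱼ‖` (the constant of `wsumBound_le_of_forall_abs_le`). [folklore] -/
def basisSum4 : ℝ := ∑ i, ∑ j, ∑ a, ∑ c, ‖b c‖ * ‖b i‖ * ‖b a‖ * ‖b j‖

omit [DecidableEq ι] in
/-- `basisSum b ≥ 0`. [folklore] -/
theorem basisSum_nonneg : 0 ≤ basisSum b := Finset.sum_nonneg fun _ _ ↦ norm_nonneg _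

omit [DecidableEq ι] in
/-- `basisSum4 b ≥ 0`. [folklore] -/
theorem basisSum4_nonneg : 0 ≤ basisSum4 b :=
  Finset.sum_nonneg fun _ _ ↦ Finset.sum_nonneg fun _ _ ↦ Finset.sum_nonneg fun _ _ ↦
    Finset.sum_nonneg fun _ _ ↦ by positivity

omit [DecidableEq ι] in
/-- `‖bₚ‖ ≤ basisSum b`. [folklore] -/
theorem norm_basis_le (p : ι) : ‖b p‖ ≤ basisSum b :=
  Finset.single_le_sum (f := fun p ↦ ‖b p‖) (fun _ _ ↦ norm_nonneg _) (Finset.mem_univ p)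

omit [DecidableEq ι] in
/-- **Leibniz expansion of the Hessian of `⟨H, H⟩` with controlled remainder.** For weights
`wf(y)` and forms `H(y)` of class `C²` at `x`, with `‖D(wf)(x)‖ ≤ R₁`, `‖D²(wf)(x)‖ ≤ R₂`
entrywise: `∂ₚ∂_q [wsum (wf y) (H y) (H y)] = ⟨∂ₚ∂_qH, H⟩ + ⟨H, ∂ₚ∂_qH⟩ + ⟨∂ₚH, ∂_qH⟩ + ⟨∂_qH, ∂ₚH⟩
+ rem`, `|rem| ≤ R₂ Bb² Nb ‖H‖² + 2 R₁ Bb Nb ‖H‖ (‖∂ₚH‖ + ‖∂_qH‖)` (`fderiv_fderiv_wsum_apply`,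
`abs_wsum_le`, `wsumBound_le_of_forall_abs_le`). [folklore] -/
theorem wsum_hessian_decomposition {wf : E → ι → ι → ι → ι → ℝ} {Hf : E → E →L[ℝ] E →L[ℝ] ℝ}
    {x : E} (hw : ∀ i j a c, ContDiffAt ℝ 2 (fun y ↦ wf y i j a c) x) (hH : ContDiffAt ℝ 2 Hf x)
    {R₁ R₂ : ℝ} (hR₁ : ∀ i j a c, ‖fderiv ℝ (fun y ↦ wf y i j a c) x‖ ≤ R₁)
    (hR₂ : ∀ i j a c, ‖fderiv ℝ (fderiv ℝ (fun y ↦ wf y i j a c)) x‖ ≤ R₂) :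
    ∃ rem : ι → ι → ℝ,
      (∀ p q, fderiv ℝ (fderiv ℝ (fun y ↦ wsum b (wf y) (Hf y) (Hf y))) x (b p) (b q) =
        wsum b (wf x) (fderiv ℝ (fderiv ℝ Hf) x (b p) (b q)) (Hf x)
          + wsum b (wf x) (Hf x) (fderiv ℝ (fderiv ℝ Hf) x (b p) (b q))
          + wsum b (wf x) (fderiv ℝ Hf x (b p)) (fderiv ℝ Hf x (b q))
          + wsum b (wf x) (fderiv ℝ Hf x (b q)) (fderiv ℝ Hf x (b p)) + rem p q) ∧
      ∀ p q, |rem p q| ≤ R₂ * basisSum b ^ 2 * basisSum4 b * ‖Hf x‖ ^ 2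
        + 2 * (R₁ * basisSum b * basisSum4 b) * ‖Hf x‖
          * (‖fderiv ℝ Hf x (b p)‖ + ‖fderiv ℝ Hf x (b q)‖) := by
  refine ⟨fun p q ↦
      wsum b (fun i j a c ↦ fderiv ℝ (fderiv ℝ (fun y ↦ wf y i j a c)) x (b p) (b q)) (Hf x) (Hf x)
      + wsum b (fun i j a c ↦ fderiv ℝ (fun y ↦ wf y i j a c) x (b p)) (fderiv ℝ Hf x (b q)) (Hf x)
      + wsum b (fun i j a c ↦ fderiv ℝ (fun y ↦ wf y i j a c) x (b q)) (fderiv ℝ Hf x (b p)) (Hf x)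
      + wsum b (fun i j a c ↦ fderiv ℝ (fun y ↦ wf y i j a c) x (b p)) (Hf x) (fderiv ℝ Hf x (b q))
      + wsum b (fun i j a c ↦ fderiv ℝ (fun y ↦ wf y i j a c) x (b q)) (Hf x) (fderiv ℝ Hf x (b p)),
    fun p q ↦ ?_, fun p q ↦ ?_⟩
  · dsimp only
    rw [fderiv_fderiv_wsum_apply b hw hH]
    ring
  · dsimp only
    have hB := basisSum_nonneg b
    have hN := basisSum4_nonneg b
    have hR₁0 : 0 ≤ R₁ := (norm_nonneg _).trans (hR₁ p p p p)
    have hR₂0 : 0 ≤ R₂ := (norm_nonneg _).trans (hR₂ p p p p)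
    -- entrywise bounds of the derivative weight arrays
    have hw1 : ∀ (r : ι) (i j a c : ι), |fderiv ℝ (fun y ↦ wf y i j a c) x (b r)| ≤ R₁ * basisSum b := by
      intro r i j a c
      rw [← Real.norm_eq_abs]
      calc ‖fderiv ℝ (fun y ↦ wf y i j a c) x (b r)‖
          ≤ ‖fderiv ℝ (fun y ↦ wf y i j a c) x‖ * ‖b r‖ := le_opNorm _ _
        _ ≤ R₁ * basisSum b :=
            mul_le_mul (hR₁ i j a c) (norm_basis_le b r) (norm_nonneg _) hR₁0
    have hw2 : ∀ i j a c, |fderiv ℝ (fderiv ℝ (fun y ↦ wf y i j a c)) x (b p) (b q)| ≤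
        R₂ * basisSum b ^ 2 := by
      intro i j a c
      rw [← Real.norm_eq_abs]
      calc ‖fderiv ℝ (fderiv ℝ (fun y ↦ wf y i j a c)) x (b p) (b q)‖
          ≤ ‖fderiv ℝ (fderiv ℝ (fun y ↦ wf y i j a c)) x‖ * ‖b p‖ * ‖b q‖ :=
            (fderiv ℝ (fderiv ℝ (fun y ↦ wf y i j a c)) x (b p)).le_of_opNorm_le (le_opNorm _ _) _
        _ ≤ R₂ * basisSum b * basisSum b :=
            mul_le_mul (mul_le_mul (hR₂ i j a c) (norm_basis_le b p) (norm_nonneg _) hR₂0)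
              (norm_basis_le b q) (norm_nonneg _) (mul_nonneg hR₂0 hB)
        _ = R₂ * basisSum b ^ 2 := by ring
    have hb2 : wsumBound b (fun i j a c ↦ fderiv ℝ (fderiv ℝ (fun y ↦ wf y i j a c)) x (b p) (b q))
        ≤ R₂ * basisSum b ^ 2 * basisSum4 b := wsumBound_le_of_forall_abs_le b hw2
    have hb1 : ∀ r, wsumBound b (fun i j a c ↦ fderiv ℝ (fun y ↦ wf y i j a c) x (b r))
        ≤ R₁ * basisSum b * basisSum4 b := fun r ↦ wsumBound_le_of_forall_abs_le b (hw1 r)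
    -- the five terms
    set h0 := ‖Hf x‖ with hh0
    set dp := ‖fderiv ℝ Hf x (b p)‖ with hdp
    set dq := ‖fderiv ℝ Hf x (b q)‖ with hdq
    have h00 : 0 ≤ h0 := norm_nonneg _
    have hdp0 : 0 ≤ dp := norm_nonneg _
    have hdq0 : 0 ≤ dq := norm_nonneg _
    have e5 : |wsum b (fun i j a c ↦ fderiv ℝ (fderiv ℝ (fun y ↦ wf y i j a c)) x (b p) (b q))
        (Hf x) (Hf x)| ≤ R₂ * basisSum b ^ 2 * basisSum4 b * h0 * h0 :=
      (abs_wsum_le b _ _ _).trans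
        (mul_le_mul_of_nonneg_right (mul_le_mul_of_nonneg_right hb2 h00) h00)
    have e6 : |wsum b (fun i j a c ↦ fderiv ℝ (fun y ↦ wf y i j a c) x (b p))
        (fderiv ℝ Hf x (b q)) (Hf x)| ≤ R₁ * basisSum b * basisSum4 b * dq * h0 :=
      (abs_wsum_le b _ _ _).trans
        (mul_le_mul_of_nonneg_right (mul_le_mul_of_nonneg_right (hb1 p) hdq0) h00)
    have e7 : |wsum b (fun i j a c ↦ fderiv ℝ (fun y ↦ wf y i j a c) x (b q))
        (fderiv ℝ Hf x (b p)) (Hf x)| ≤ R₁ * basisSum b * basisSum4 b * dp * h0 :=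
      (abs_wsum_le b _ _ _).trans
        (mul_le_mul_of_nonneg_right (mul_le_mul_of_nonneg_right (hb1 q) hdp0) h00)
    have e8 : |wsum b (fun i j a c ↦ fderiv ℝ (fun y ↦ wf y i j a c) x (b p))
        (Hf x) (fderiv ℝ Hf x (b q))| ≤ R₁ * basisSum b * basisSum4 b * h0 * dq :=
      (abs_wsum_le b _ _ _).trans
        (mul_le_mul_of_nonneg_right (mul_le_mul_of_nonneg_right (hb1 p) h00) hdq0)
    have e9 : |wsum b (fun i j a c ↦ fderiv ℝ (fun y ↦ wf y i j a c) x (b q))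
        (Hf x) (fderiv ℝ Hf x (b p))| ≤ R₁ * basisSum b * basisSum4 b * h0 * dp :=
      (abs_wsum_le b _ _ _).trans
        (mul_le_mul_of_nonneg_right (mul_le_mul_of_nonneg_right (hb1 q) h00) hdp0)
    have habs : ∀ t₅ t₆ t₇ t₈ t₉ : ℝ,
        |t₅ + t₆ + t₇ + t₈ + t₉| ≤ |t₅| + |t₆| + |t₇| + |t₈| + |t₉| := by
      intro t₅ t₆ t₇ t₈ t₉
      have h1 := abs_add_le (t₅ + t₆ + t₇ + t₈) t₉
      have h2 := abs_add_le (t₅ + t₆ + t₇) t₈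
      have h3 := abs_add_le (t₅ + t₆) t₇
      have h4 := abs_add_le t₅ t₆
      linarith
    refine (habs _ _ _ _ _).trans ?_
    have hsum := add_le_add (add_le_add (add_le_add (add_le_add e5 e6) e7) e8) e9
    refine hsum.trans (le_of_eq ?_)
    ring

variable [FiniteDimensional ℝ E]

/-- `∑ₚ ‖bᵖ‖`, `bᵖ` the coordinate functionals. [folklore] -/
def coordSum : ℝ := ∑ p, ‖(b.coord p).toContinuousLinearMap‖

/-- `∑ ‖bᶜ‖ ‖bⁱ‖` (the constant of `norm_bilinOfCoeffs_le`). [folklore] -/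
def coordSum2 : ℝ :=
  ∑ c, ∑ i, ‖(b.coord c).toContinuousLinearMap‖ * ‖(b.coord i).toContinuousLinearMap‖

omit [DecidableEq ι] in
/-- `coordSum b ≥ 0`. [folklore] -/
theorem coordSum_nonneg : 0 ≤ coordSum b := Finset.sum_nonneg fun _ _ ↦ norm_nonneg _

omit [DecidableEq ι] in
/-- `coordSum2 b ≥ 0`. [folklore] -/
theorem coordSum2_nonneg : 0 ≤ coordSum2 b :=
  Finset.sum_nonneg fun _ _ ↦ Finset.sum_nonneg fun _ _ ↦ by positivity

omit [DecidableEq ι] in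
/-- `‖bᵖ‖ ≤ coordSum b`. [folklore] -/
theorem norm_coord_le (p : ι) : ‖(b.coord p).toContinuousLinearMap‖ ≤ coordSum b :=
  Finset.single_le_sum (f := fun p ↦ ‖(b.coord p).toContinuousLinearMap‖)
    (fun _ _ ↦ norm_nonneg _) (Finset.mem_univ p)

omit [DecidableEq ι] in
/-- **The pairing of a form with prescribed small components is small**:
`|⟨bilinOfCoeffs b f, T⟩| ≤ K₀ (D Nc) ‖T‖` when `|f c i| ≤ D` and `normSqCoordBound ≤ K₀`
(`abs_normSqCoord_le`, `norm_bilinOfCoeffs_le`). [folklore] -/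
theorem abs_normSqCoord_bilinOfCoeffs_le (Gi : Matrix ι ι ℝ) {f : ι → ι → ℝ} {D K₀ : ℝ}
    (hD : ∀ c i, |f c i| ≤ D) (hK₀ : normSqCoordBound b Gi ≤ K₀)
    (T : E →L[ℝ] E →L[ℝ] ℝ) :
    |normSqCoord b Gi (bilinOfCoeffs b f) T| ≤ K₀ * (D * coordSum2 b) * ‖T‖ := by
  have hK₀0 : 0 ≤ K₀ := (normSqCoordBound_nonneg b Gi).trans hK₀
  have hB : ‖bilinOfCoeffs b f‖ ≤ D * coordSum2 b := by
    refine (norm_bilinOfCoeffs_le b f).trans ?_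
    rw [coordSum2, Finset.mul_sum]
    refine Finset.sum_le_sum fun c _ ↦ ?_
    rw [Finset.mul_sum]
    refine Finset.sum_le_sum fun i _ ↦ ?_
    have h := hD c i
    calc |f c i| * ‖(b.coord c).toContinuousLinearMap‖ * ‖(b.coord i).toContinuousLinearMap‖
        = |f c i| * (‖(b.coord c).toContinuousLinearMap‖ * ‖(b.coord i).toContinuousLinearMap‖) := by
          ring
      _ ≤ D * (‖(b.coord c).toContinuousLinearMap‖ * ‖(b.coord i).toContinuousLinearMap‖) :=
          mul_le_mul_of_nonneg_right h (by positivity)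
  calc |normSqCoord b Gi (bilinOfCoeffs b f) T|
      ≤ normSqCoordBound b Gi * ‖bilinOfCoeffs b f‖ * ‖T‖ := abs_normSqCoord_le b Gi _ T
    _ ≤ K₀ * (D * coordSum2 b) * ‖T‖ :=
        mul_le_mul_of_nonneg_right (mul_le_mul hK₀ hB (norm_nonneg _) hK₀0) (norm_nonneg _)

end Generic

/-! ### The decomposition of `∂ₜ(G¹ - G²)` -/

section MaxPoint

variable {E : Type*} [NormedAddCommGroup E] [NormedSpace ℝ E] {H : Type*} [TopologicalSpace H]
  {I : ModelWithCorners ℝ E H} [I.Boundaryless] {M : Type*} [TopologicalSpace M]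
  [ChartedSpace H M] [IsManifold I ∞ M] [FiniteDimensional ℝ E]
  {ι : Type*} [Fintype ι] [DecidableEq ι]

/-- The derivative of the difference of two time slices is the difference of the derivatives,
on the chart target. [folklore] -/
theorem fderiv_sub_chartRep {k₁ k₂ : ℝ → PseudoRiemannianMetric I ∞ E (TangentSpace I : M → Type _)}
    {S : Set ℝ} (hk₁ : IsContMDiffFamilyOn ∞ k₁ S) (hk₂ : IsContMDiffFamilyOn ∞ k₂ S) (z : M)
    {t : ℝ} (ht : t ∈ S) (y₀ : chartTarget I z) :
    fderiv ℝ (fun y ↦ chartRep I k₁ z t y - chartRep I k₂ z t y) y₀ =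
      fderiv ℝ (chartRep I k₁ z t) y₀ - fderiv ℝ (chartRep I k₂ z t) y₀ := by
  have htgt : IsOpen (extChartAt I z).target := isOpen_extChartAt_target z
  have hd : ∀ {k : ℝ → PseudoRiemannianMetric I ∞ E (TangentSpace I : M → Type _)},
      IsContMDiffFamilyOn ∞ k S → DifferentiableAt ℝ (chartRep I k z t) y₀ := fun hk ↦
    ((contDiffOn_chartRep_slice hk z ht).differentiableOn (by simp)).differentiableAt
      (htgt.mem_nhds y₀.2)
  exact fderiv_fun_sub (hd hk₁) (hd hk₂)

/-- The second derivative of the difference of two time slices is the difference of the second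
derivatives, on the chart target. [folklore] -/
theorem fderiv_fderiv_sub_chartRep
    {k₁ k₂ : ℝ → PseudoRiemannianMetric I ∞ E (TangentSpace I : M → Type _)}
    {S : Set ℝ} (hk₁ : IsContMDiffFamilyOn ∞ k₁ S) (hk₂ : IsContMDiffFamilyOn ∞ k₂ S) (z : M)
    {t : ℝ} (ht : t ∈ S) (y₀ : chartTarget I z) :
    fderiv ℝ (fderiv ℝ (fun y ↦ chartRep I k₁ z t y - chartRep I k₂ z t y)) y₀ =
      fderiv ℝ (fderiv ℝ (chartRep I k₁ z t)) y₀ - fderiv ℝ (fderiv ℝ (chartRep I k₂ z t)) y₀ := by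
  have htgt : IsOpen (extChartAt I z).target := isOpen_extChartAt_target z
  have hev : fderiv ℝ (fun y ↦ chartRep I k₁ z t y - chartRep I k₂ z t y) =ᶠ[𝓝 (y₀ : E)]
      fun y ↦ fderiv ℝ (chartRep I k₁ z t) y - fderiv ℝ (chartRep I k₂ z t) y := by
    filter_upwards [htgt.mem_nhds y₀.2] with y hy
    exact fderiv_sub_chartRep hk₁ hk₂ z ht ⟨y, hy⟩
  have hdd : ∀ {k : ℝ → PseudoRiemannianMetric I ∞ E (TangentSpace I : M → Type _)},
      IsContMDiffFamilyOn ∞ k S → DifferentiableAt ℝ (fderiv ℝ (chartRep I k z t)) y₀ := fun hk ↦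
    ((contDiffOn_fderiv_chartRep_slice hk z ht).differentiableOn (by simp)).differentiableAt
      (htgt.mem_nhds y₀.2)
  rw [hev.fderiv_eq]
  exact fderiv_fun_sub (hdd hk₁) (hdd hk₂)

omit [I.Boundaryless] [FiniteDimensional ℝ E] in
/-- **The lower-order term on basis vectors depends on the background only through the arrays
`Γ̃(bᵢ, bⱼ)`, `∂ₚΓ̃(bᵢ, bⱼ)`** (`rdtLower_congr_background`), i.e. it is `rdtLower` with the
background in the `Cfun`/`DCfun` form of `exists_lipschitz_rdtLower`. [folklore] -/
theorem chartLower_basis_eq (b : Module.Basis ι ℝ E)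
    (k : ℝ → PseudoRiemannianMetric I ∞ E (TangentSpace I : M → Type _))
    (h : PseudoRiemannianMetric I ∞ E (TangentSpace I : M → Type _)) (z : M) (t : ℝ) (y : E)
    (c i : ι) :
    chartLower I b k h z t y (b c) (b i) =
      rdtLower b (chartRep I k z t y) (gramInv b (chartRep I k z t y)) (fderiv ℝ (chartRep I k z t) y)
        (Cfun b fun i j ↦ bgChris I b h z y (b i) (b j))
        (DCfun b fun p i j ↦ fderiv ℝ (fun y' : E ↦ bgChris I b h z y' (b i) (b j)) y (b p))
        (b c) (b i) := by
  unfold chartLower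
  exact rdtLower_congr_background b _ _ _ (fun i j ↦ by rw [Cfun_basis])
    (fun p i j ↦ by rw [DCfun_basis]) c i

/-- **Decomposition of `⟨∂ₜ(G¹ - G²), T⟩`.** With `H = G¹_t - G²_t`, `gₐ⁻¹ = gramInv b (Gᵃ_t y₀)`:
`⟨chartDot, T⟩ = ⟨g₁ᵖ𐞥 ∂ₚ∂_q H, T⟩ + ⟨(g₁ᵖ𐞥 - g₂ᵖ𐞥) ∂ₚ∂_q G², T⟩ + ⟨B(F₁ - F₂), T⟩`, where
`B(F₁ - F₂) = bilinOfCoeffs b (chartLower k₁ - chartLower k₂)` carries the difference of the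
lower-order terms (the pairing `normSqCoord b Gi X T` sees `X` only through its components on
basis pairs, and on basis pairs `∂ₜ(G¹ - G²) = (g₁∂∂G¹ + F₁) - (g₂∂∂G² + F₂)` regroups as
displayed). This is the splitting `hHdot` of `JetEstimate.two_mul_ip_le`.
[cite: AndrewsHopper2011, §5.4.2, Step 1] -/
theorem normSqCoord_chartDot_eq (b : Module.Basis ι ℝ E)
    {k₁ k₂ : ℝ → PseudoRiemannianMetric I ∞ E (TangentSpace I : M → Type _)} {S : Set ℝ}
    (hk₁ : IsContMDiffFamilyOn ∞ k₁ S) (hk₂ : IsContMDiffFamilyOn ∞ k₂ S)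
    (h : PseudoRiemannianMetric I ∞ E (TangentSpace I : M → Type _)) (z : M) {t : ℝ} (ht : t ∈ S)
    (y₀ : chartTarget I z) (Gi : Matrix ι ι ℝ) (T : E →L[ℝ] E →L[ℝ] ℝ) :
    normSqCoord b Gi (chartDot I b h k₁ k₂ z t y₀) T =
      normSqCoord b Gi (∑ p, ∑ q, gramInv b (chartRep I k₁ z t y₀) q p •
          fderiv ℝ (fderiv ℝ (fun y ↦ chartRep I k₁ z t y - chartRep I k₂ z t y)) y₀ (b p) (b q)) T
      + normSqCoord b Gi (∑ p, ∑ q,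
          (gramInv b (chartRep I k₁ z t y₀) q p - gramInv b (chartRep I k₂ z t y₀) q p) •
            fderiv ℝ (fderiv ℝ (chartRep I k₂ z t)) y₀ (b p) (b q)) T
      + normSqCoord b Gi (bilinOfCoeffs b fun c i ↦
          chartLower I b k₁ h z t y₀ (b c) (b i) - chartLower I b k₂ h z t y₀ (b c) (b i)) T := by
  have hD2 := fderiv_fderiv_sub_chartRep hk₁ hk₂ z ht y₀
  rw [← normSqCoord_add_left, ← normSqCoord_add_left]
  refine normSqCoord_congr_left b Gi (fun c i ↦ ?_) T
  rw [chartDot, bilinOfCoeffs_basis]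
  simp only [_root_.add_apply, FunLike.coe_sum, Finset.sum_apply, FunLike.coe_smul,
    Pi.smul_apply, smul_eq_mul, bilinOfCoeffs_basis, hD2, _root_.sub_apply, chartRHS]
  have key : ∀ (g₁ g₂ Q₁ Q₂ : ι → ι → ℝ),
      (∑ p, ∑ q, g₁ q p * Q₁ p q) - (∑ p, ∑ q, g₂ q p * Q₂ p q) =
        (∑ p, ∑ q, g₁ q p * (Q₁ p q - Q₂ p q)) + ∑ p, ∑ q, (g₁ q p - g₂ q p) * Q₂ p q := by
    intro g₁ g₂ Q₁ Q₂
    simp only [← Finset.sum_sub_distrib, ← Finset.sum_add_distrib]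
    refine Finset.sum_congr rfl fun p _ ↦ Finset.sum_congr rfl fun q _ ↦ ?_
    ring
  have hk : (∑ p, ∑ q, gramInv b (chartRep I k₁ z t y₀) q p *
        fderiv ℝ (fderiv ℝ (chartRep I k₁ z t)) y₀ (b p) (b q) (b c) (b i))
      - (∑ p, ∑ q, gramInv b (chartRep I k₂ z t y₀) q p *
        fderiv ℝ (fderiv ℝ (chartRep I k₂ z t)) y₀ (b p) (b q) (b c) (b i)) =
      (∑ p, ∑ q, gramInv b (chartRep I k₁ z t y₀) q p *
        (fderiv ℝ (fderiv ℝ (chartRep I k₁ z t)) y₀ (b p) (b q) (b c) (b i)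
          - fderiv ℝ (fderiv ℝ (chartRep I k₂ z t)) y₀ (b p) (b q) (b c) (b i)))
      + ∑ p, ∑ q, (gramInv b (chartRep I k₁ z t y₀) q p - gramInv b (chartRep I k₂ z t y₀) q p) *
        fderiv ℝ (fderiv ℝ (chartRep I k₂ z t)) y₀ (b p) (b q) (b c) (b i) :=
    key _ _ (fun p q ↦ fderiv ℝ (fderiv ℝ (chartRep I k₁ z t)) y₀ (b p) (b q) (b c) (b i))
      (fun p q ↦ fderiv ℝ (fderiv ℝ (chartRep I k₂ z t)) y₀ (b p) (b q) (b c) (b i))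
  linarith [hk]

/-! ### The maximum-point estimate -/

set_option maxHeartbeats 400000 in
/-- **The maximum-point estimate for two families read in a chart** (Andrews–Hopper 2011,
§5.4.2, Step 1; Topping 2006, §5.2 with the maximum principle of §3.1). Let `k₁, k₂` be
families of metrics `C^∞` on `M × [0, δ]` with `k₁ t` Riemannian, `h` a Riemannian background,
`z ∈ M` and `K` a compact subset of the chart target at `z`. There is a constant `C` such that
for every `t ∈ [0, δ]` and every local maximum `y₀ ∈ K` of `û_t = |G¹_t - G²_t|²_h`
(`chartNormSq`), `2 ⟨∂ₜ(G¹ - G²), G¹_t - G²_t⟩_h (y₀) ≤ C û_t(y₀)`, where `∂ₜ(G¹ - G²) = chartDot`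
is the difference of the right-hand sides of the coordinate Ricci–DeTurck equations
(`IsRicciDeTurckFlow.hasDerivWithinAt_chartRep`). Proof: `JetEstimate.two_mul_ip_le` with the
sum-of-squares pairing `⟨·,·⟩_{h(y₀)}` (`isSumOfSquares_normSqCoord`), coercivity
(`exists_pos_mul_norm_sq_le_normSqCoord`), uniform ellipticity of `g₁⁻¹`
(`exists_ellipticity_const`), the sign `g₁ᵖ𐞥∂ₚ∂_qû ≤ 0` (`sum_gramInv_fderiv_fderiv_nonpos`),
the Leibniz expansion (`wsum_hessian_decomposition`), the splitting `normSqCoord_chartDot_eq`,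
the Lipschitz bounds `abs_gramInv_sub_gramInv_le`, `exists_lipschitz_rdtLower`, and constants
from continuity of all data on the compact `K × [0, δ]`.
[cite: AndrewsHopper2011, §5.4.2, Step 1] [cite: Topping2006, §5.2] -/
theorem exists_maxPoint_const (b : Module.Basis ι ℝ E)
    {k₁ k₂ : ℝ → PseudoRiemannianMetric I ∞ E (TangentSpace I : M → Type _)} {δ : ℝ}
    (hδ : 0 < δ) (hk₁ : IsContMDiffFamilyOn ∞ k₁ (Icc 0 δ)) (hk₂ : IsContMDiffFamilyOn ∞ k₂ (Icc 0 δ))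
    (hR₁ : ∀ t ∈ Icc 0 δ, (k₁ t).IsRiemannian)
    {h : PseudoRiemannianMetric I ∞ E (TangentSpace I : M → Type _)} (hh : h.IsRiemannian)
    (z : M) {K : Set E} (hK : IsCompact K) (hKt : K ⊆ (extChartAt I z).target) :
    ∃ C : ℝ, ∀ t ∈ Icc 0 δ, ∀ y₀ ∈ K, IsLocalMax (chartNormSq I b h k₁ k₂ z t) y₀ →
      2 * normSqCoord b (gramInv b (chartRep I (fun _ ↦ h) z 0 y₀)) (chartDot I b h k₁ k₂ z t y₀)
          (chartRep I k₁ z t y₀ - chartRep I k₂ z t y₀) ≤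
        C * chartNormSq I b h k₁ k₂ z t y₀ := by
  -- the sets
  have htgt : IsOpen (extChartAt I z).target := isOpen_extChartAt_target z
  have hS : UniqueDiffOn ℝ (Icc 0 δ) := uniqueDiffOn_Icc hδ
  have hPc : IsCompact (K ×ˢ Icc 0 δ) := hK.prod isCompact_Icc
  have hPsub : K ×ˢ Icc 0 δ ⊆ (extChartAt I z).target ×ˢ Icc 0 δ := prod_mono hKt Subset.rfl
  have hH : ∀ y : chartTarget I z, (chartPullback I h z).val y = chartRep I (fun _ ↦ h) z 0 y :=
    val_chartPullback_eq_chartRep (fun _ ↦ h) z 0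
  have hh' : (chartPullback I h z).IsRiemannian := fun y v hv ↦
    chartPullback_pos h z y (fun w hw ↦ hh _ w hw) v hv
  -- continuity of the data of the two families on `target × [0, δ]`
  have cG : ∀ {k : ℝ → PseudoRiemannianMetric I ∞ E (TangentSpace I : M → Type _)},
      IsContMDiffFamilyOn ∞ k (Icc 0 δ) →
      ContinuousOn (fun q : E × ℝ ↦ chartRep I k z q.2 q.1) ((extChartAt I z).target ×ˢ Icc 0 δ) :=
    fun hk ↦ (contDiffOn_chartRep hk z).continuousOn
  have cD : ∀ {k : ℝ → PseudoRiemannianMetric I ∞ E (TangentSpace I : M → Type _)},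
      IsContMDiffFamilyOn ∞ k (Icc 0 δ) →
      ContinuousOn (fun q : E × ℝ ↦ fderiv ℝ (chartRep I k z q.2) q.1)
        ((extChartAt I z).target ×ˢ Icc 0 δ) :=
    fun hk ↦ (ContDiffOn.fderiv_slice htgt hS (contDiffOn_chartRep hk z)).continuousOn
  have cDD : ∀ {k : ℝ → PseudoRiemannianMetric I ∞ E (TangentSpace I : M → Type _)},
      IsContMDiffFamilyOn ∞ k (Icc 0 δ) →
      ContinuousOn (fun q : E × ℝ ↦ fderiv ℝ (fderiv ℝ (chartRep I k z q.2)) q.1)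
        ((extChartAt I z).target ×ˢ Icc 0 δ) :=
    fun hk ↦ (ContDiffOn.fderiv_fderiv_slice htgt hS (contDiffOn_chartRep hk z)).continuousOn
  have cGi : ∀ {k : ℝ → PseudoRiemannianMetric I ∞ E (TangentSpace I : M → Type _)},
      IsContMDiffFamilyOn ∞ k (Icc 0 δ) →
      ContinuousOn (fun q : E × ℝ ↦ (fun j i ↦ gramInv b (chartRep I k z q.2 q.1) j i : ι → ι → ℝ))
        ((extChartAt I z).target ×ˢ Icc 0 δ) :=
    fun hk ↦ continuousOn_pi.2 fun j ↦ continuousOn_pi.2 fun i ↦ continuousOn_gramInv_chartRep b hk z j i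
  -- continuity of the background data on the target
  have cGi0 : ContinuousOn
      (fun y : E ↦ (fun j i ↦ gramInv b (chartRep I (fun _ ↦ h) z 0 y) j i : ι → ι → ℝ))
      (extChartAt I z).target :=
    continuousOn_pi.2 fun j ↦ continuousOn_pi.2 fun i ↦
      (contDiffOn_gramInv_chartRep_const b h z j i).continuousOn
  have cCv : ContinuousOn (fun y : E ↦ (fun i j ↦ bgChris I b h z y (b i) (b j) : ι → ι → E))
      (extChartAt I z).target :=
    continuousOn_pi.2 fun i ↦ continuousOn_pi.2 fun j ↦ (contDiffOn_bgChris b h z (b i) (b j)).continuousOn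
  have cDCv : ContinuousOn (fun y : E ↦ (fun p i j ↦
      fderiv ℝ (fun y' : E ↦ bgChris I b h z y' (b i) (b j)) y (b p) : ι → ι → ι → E))
      (extChartAt I z).target :=
    continuousOn_pi.2 fun p ↦ continuousOn_pi.2 fun i ↦ continuousOn_pi.2 fun j ↦
      (continuousOn_fderiv_bgChris b h z (b i) (b j)).clm_apply continuousOn_const
  -- the weights `w0 = g⁰ ⊗ g⁰` of the pairing and their derivatives
  set w0 : E → ι → ι → ι → ι → ℝ := fun y i j a c ↦
    gramInv b (chartRep I (fun _ ↦ h) z 0 y) j i * gramInv b (chartRep I (fun _ ↦ h) z 0 y) c a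
    with hw0def
  have hw0 : ∀ i j a c, ContDiffOn ℝ ∞ (fun y ↦ w0 y i j a c) (extChartAt I z).target :=
    fun i j a c ↦ (contDiffOn_gramInv_chartRep_const b h z j i).mul
      (contDiffOn_gramInv_chartRep_const b h z c a)
  have cW1 : ContinuousOn (fun y : E ↦ (fun i j a c ↦ fderiv ℝ (fun y' ↦ w0 y' i j a c) y :
      ι → ι → ι → ι → (E →L[ℝ] ℝ))) (extChartAt I z).target :=
    continuousOn_pi.2 fun i ↦ continuousOn_pi.2 fun j ↦ continuousOn_pi.2 fun a ↦
      continuousOn_pi.2 fun c ↦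
        (hw0 i j a c).continuousOn_fderiv_of_isOpen htgt (by exact_mod_cast le_top)
  have cW2 : ContinuousOn (fun y : E ↦ (fun i j a c ↦
      fderiv ℝ (fderiv ℝ (fun y' ↦ w0 y' i j a c)) y : ι → ι → ι → ι → (E →L[ℝ] E →L[ℝ] ℝ)))
      (extChartAt I z).target :=
    continuousOn_pi.2 fun i ↦ continuousOn_pi.2 fun j ↦ continuousOn_pi.2 fun a ↦
      continuousOn_pi.2 fun c ↦
        ((hw0 i j a c).fderiv_of_isOpen (m := ∞) htgt (le_of_eq rfl)).continuousOn_fderiv_of_isOpen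
          htgt (by exact_mod_cast le_top)
  -- the data tuples of the two families
  have lCv := cCv.comp continuous_fst.continuousOn
    (fun (q : E × ℝ) (hq : q ∈ (extChartAt I z).target ×ˢ Icc 0 δ) ↦ hq.1)
  have lDCv := cDCv.comp continuous_fst.continuousOn
    (fun (q : E × ℝ) (hq : q ∈ (extChartAt I z).target ×ˢ Icc 0 δ) ↦ hq.1)
  have cdat : ∀ {k : ℝ → PseudoRiemannianMetric I ∞ E (TangentSpace I : M → Type _)},
      IsContMDiffFamilyOn ∞ k (Icc 0 δ) →
      ContinuousOn (fun q : E × ℝ ↦ ((chartRep I k z q.2 q.1,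
        (fun j i ↦ gramInv b (chartRep I k z q.2 q.1) j i),
        fderiv ℝ (chartRep I k z q.2) q.1,
        (fun i j ↦ bgChris I b h z q.1 (b i) (b j)),
        (fun p i j ↦ fderiv ℝ (fun y' : E ↦ bgChris I b h z y' (b i) (b j)) q.1 (b p))) : Dat E ι))
        (K ×ˢ Icc 0 δ) :=
    fun hk ↦ ((cG hk).prodMk ((cGi hk).prodMk ((cD hk).prodMk (lCv.prodMk lDCv)))).mono hPsub
  -- the constants
  obtain ⟨R₁', hR₁'0, hR₁'⟩ := exists_nonneg_forall_norm_le (Y := Dat E ι) hPc (cdat hk₁)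
  obtain ⟨R₂', hR₂'0, hR₂'⟩ := exists_nonneg_forall_norm_le (Y := Dat E ι) hPc (cdat hk₂)
  have cQ₂ : ContinuousOn (fun q : E × ℝ ↦ (fun p q' ↦
      fderiv ℝ (fderiv ℝ (chartRep I k₂ z q.2)) q.1 (b p) (b q') : ι → ι → (E →L[ℝ] E →L[ℝ] ℝ)))
      (K ×ˢ Icc 0 δ) :=
    continuousOn_pi.2 fun p ↦ continuousOn_pi.2 fun q' ↦
      (((cDD hk₂).clm_apply continuousOn_const).clm_apply continuousOn_const).mono hPsub
  obtain ⟨R₃, hR₃0, hR₃⟩ := exists_nonneg_forall_norm_le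
    (Y := ι → ι → (E →L[ℝ] E →L[ℝ] ℝ)) hPc cQ₂
  obtain ⟨R₅, hR₅0, hR₅⟩ := exists_nonneg_forall_norm_le (Y := ι → ι → ℝ) hK (cGi0.mono hKt)
  obtain ⟨R₆, hR₆0, hR₆⟩ := exists_nonneg_forall_norm_le (Y := ι → ι → ι → ι → (E →L[ℝ] ℝ)) hK
    (cW1.mono hKt)
  obtain ⟨R₇, hR₇0, hR₇⟩ := exists_nonneg_forall_norm_le
    (Y := ι → ι → ι → ι → (E →L[ℝ] E →L[ℝ] ℝ)) hK (cW2.mono hKt)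
  set R := R₁' + R₂' with hRdef
  have hR0 : 0 ≤ R := add_nonneg hR₁'0 hR₂'0
  obtain ⟨L, hL0, hL⟩ := exists_lipschitz_rdtLower (E := E) (ι := ι) b R
  obtain ⟨μ, hμ, hcoer⟩ := exists_pos_mul_norm_sq_le_normSqCoord hH b hh' hK hKt
  obtain ⟨lam, hlam, hell⟩ := exists_ellipticity_const (ι := ι) hPc
    (Gi := fun (q : E × ℝ) (j i : ι) ↦ gramInv b (chartRep I k₁ z q.2 q.1) j i)
    (fun p q ↦ (continuousOn_gramInv_chartRep b hk₁ z q p).mono hPsub)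
    (fun q hq ξ hξ ↦ gramInv_chartRep_quadratic_pos b (hR₁ q.2 hq.2) z ⟨q.1, hKt hq.1⟩ hξ)
  have hBb0 : 0 ≤ basisSum b := basisSum_nonneg b
  have hNb0 : 0 ≤ basisSum4 b := basisSum4_nonneg b
  have hBc0 : 0 ≤ coordSum b := coordSum_nonneg b
  have hNc0 : 0 ≤ coordSum2 b := coordSum2_nonneg b
  set K₀ := R₅ ^ 2 * basisSum4 b with hK₀
  set K₁ := 2 * (R₆ * basisSum b * basisSum4 b) with hK₁
  set K₂ := R₇ * basisSum b ^ 2 * basisSum4 b with hK₂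
  set K₄ := R ^ 2 * basisSum b ^ 2 with hK₄
  set K₅ := R₃ with hK₅
  set K₆ := K₀ * coordSum2 b * (L * (1 + K₄ + coordSum b)) with hK₆
  have hK₀0 : 0 ≤ K₀ := by positivity
  have hK₂0 : 0 ≤ K₂ := by positivity
  have hK₄0 : 0 ≤ K₄ := by positivity
  have hK₅0 : 0 ≤ K₅ := hR₃0
  have hK₆0 : 0 ≤ K₆ := by positivity
  refine ⟨JetEstimate.estimateConst (Fintype.card ι) K₀ K₁ K₂ R K₄ K₅ K₆ lam μ,
    fun t ht y₀ hy₀ hmax ↦ ?_⟩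
  -- ### at the point `(t, y₀)`
  have hq : (y₀, t) ∈ K ×ˢ Icc 0 δ := ⟨hy₀, ht⟩
  have hy₀t : y₀ ∈ (extChartAt I z).target := hKt hy₀
  set yT : chartTarget I z := ⟨y₀, hy₀t⟩ with hyT
  -- names
  set G₁ : E → E →L[ℝ] E →L[ℝ] ℝ := chartRep I k₁ z t with hG₁
  set G₂ : E → E →L[ℝ] E →L[ℝ] ℝ := chartRep I k₂ z t with hG₂
  set Hf : E → E →L[ℝ] E →L[ℝ] ℝ := fun y ↦ G₁ y - G₂ y with hHf
  set Gi0 : Matrix ι ι ℝ := gramInv b (chartRep I (fun _ ↦ h) z 0 y₀) with hGi0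
  set Gi₁ : Matrix ι ι ℝ := gramInv b (G₁ y₀) with hGi₁
  set Gi₂ : Matrix ι ι ℝ := gramInv b (G₂ y₀) with hGi₂
  set ip : (E →L[ℝ] E →L[ℝ] ℝ) → (E →L[ℝ] E →L[ℝ] ℝ) → ℝ := fun T T' ↦ normSqCoord b Gi0 T T'
    with hipdef
  set Hv : E →L[ℝ] E →L[ℝ] ℝ := Hf y₀ with hHv
  set dH : ι → E →L[ℝ] E →L[ℝ] ℝ := fun p ↦ fderiv ℝ Hf y₀ (b p) with hdH
  set D2H : ι → ι → E →L[ℝ] E →L[ℝ] ℝ := fun p q ↦ fderiv ℝ (fderiv ℝ Hf) y₀ (b p) (b q) with hD2H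
  set Q₂ : ι → ι → E →L[ℝ] E →L[ℝ] ℝ := fun p q ↦ fderiv ℝ (fderiv ℝ G₂) y₀ (b p) (b q) with hQ₂
  set Hdot : E →L[ℝ] E →L[ℝ] ℝ := chartDot I b h k₁ k₂ z t y₀ with hHdot
  set Φ : ι → ι → ℝ := fun p q ↦
    fderiv ℝ (fderiv ℝ (fun y ↦ wsum b (w0 y) (Hf y) (Hf y))) y₀ (b p) (b q) with hΦ
  -- regularity at the point
  have hG₁a : ContDiffAt ℝ ∞ G₁ y₀ :=
    (contDiffOn_chartRep_slice hk₁ z ht).contDiffAt (htgt.mem_nhds hy₀t)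
  have hG₂a : ContDiffAt ℝ ∞ G₂ y₀ :=
    (contDiffOn_chartRep_slice hk₂ z ht).contDiffAt (htgt.mem_nhds hy₀t)
  have hHf2 : ContDiffAt ℝ 2 Hf y₀ := (hG₁a.sub hG₂a).of_le (WithTop.coe_le_coe.mpr le_top)
  have hw : ∀ i j a c, ContDiffAt ℝ 2 (fun y ↦ w0 y i j a c) y₀ := fun i j a c ↦
    ((hw0 i j a c).contDiffAt (htgt.mem_nhds hy₀t)).of_le (WithTop.coe_le_coe.mpr le_top)
  have hDH : fderiv ℝ Hf y₀ = fderiv ℝ G₁ y₀ - fderiv ℝ G₂ y₀ := fderiv_sub_chartRep hk₁ hk₂ z ht yT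
  -- component bounds from the data bounds
  have hdat₁ := hR₁' (y₀, t) hq
  have hdat₂ := hR₂' (y₀, t) hq
  have hR₁R : R₁' ≤ R := by rw [hRdef]; linarith
  have hR₂R : R₂' ≤ R := by rw [hRdef]; linarith
  have hGa₁ : ∀ j i, |Gi₁ j i| ≤ R := by
    intro j i
    have h1 := (_root_.norm_fst_le _).trans ((_root_.norm_snd_le _).trans (hdat₁.trans hR₁R))
    have h2 := (norm_le_pi_norm (fun i ↦ gramInv b (G₁ y₀) j i) i).trans
      ((norm_le_pi_norm (fun j i ↦ gramInv b (G₁ y₀) j i) j).trans h1)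
    rwa [Real.norm_eq_abs] at h2
  have hGa₂ : ∀ j i, |Gi₂ j i| ≤ R := by
    intro j i
    have h1 := (_root_.norm_fst_le _).trans ((_root_.norm_snd_le _).trans (hdat₂.trans hR₂R))
    have h2 := (norm_le_pi_norm (fun i ↦ gramInv b (G₂ y₀) j i) i).trans
      ((norm_le_pi_norm (fun j i ↦ gramInv b (G₂ y₀) j i) j).trans h1)
    rwa [Real.norm_eq_abs] at h2
  have hGi0e : ∀ j i, |Gi0 j i| ≤ R₅ := by
    intro j i
    have h1 := hR₅ y₀ hy₀
    have h2 := (norm_le_pi_norm (fun i ↦ gramInv b (chartRep I (fun _ ↦ h) z 0 y₀) j i) i).trans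
      ((norm_le_pi_norm (fun j i ↦ gramInv b (chartRep I (fun _ ↦ h) z 0 y₀) j i) j).trans h1)
    rwa [Real.norm_eq_abs] at h2
  -- ### the hypotheses of `two_mul_ip_le`
  have hip' : JetEstimate.IsSumOfSquares ip := isSumOfSquares_normSqCoord b h hh z yT
  have hcoer' : ∀ T, μ * ‖T‖ ^ 2 ≤ ip T T := fun T ↦ hcoer y₀ hy₀ T
  have hbd : ∀ T T', |ip T T'| ≤ K₀ * ‖T‖ * ‖T'‖ := by
    intro T T'
    have h1 := abs_normSqCoord_le b Gi0 T T'
    have h2 : normSqCoordBound b Gi0 ≤ K₀ := by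
      rw [normSqCoordBound_eq_wsumBound, hK₀]
      refine wsumBound_le_of_forall_abs_le b fun i j a c ↦ ?_
      rw [abs_mul, sq]
      exact mul_le_mul (hGi0e j i) (hGi0e c a) (abs_nonneg _) hR₅0
    exact h1.trans (mul_le_mul_of_nonneg_right (mul_le_mul_of_nonneg_right h2 (norm_nonneg _))
      (norm_nonneg _))
  have hsym : ∀ p q, Gi₁ p q = Gi₁ q p := gramInv_chartRep_symm b k₁ z t yT
  have hell' : ∀ ξ : ι → ℝ, lam * ∑ p, ξ p ^ 2 ≤ ∑ p, ∑ q, Gi₁ q p * ξ p * ξ q :=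
    fun ξ ↦ hell (y₀, t) hq ξ
  have hGi₁ : ∀ p q, |Gi₁ q p| ≤ R := fun p q ↦ hGa₁ q p
  have hGi : ∀ p q, |Gi₁ q p - Gi₂ q p| ≤ K₄ * ‖Hv‖ := by
    intro p q
    have hdet₁ := det_gram_repr_ne_zero (val_chartPullback_eq_chartRep k₁ z t) b yT
    have hdet₂ := det_gram_repr_ne_zero (val_chartPullback_eq_chartRep k₂ z t) b yT
    refine (abs_gramInv_sub_gramInv_le b (G₁ y₀) (G₂ y₀) hdet₁ hdet₂ q p).trans ?_
    refine mul_le_mul_of_nonneg_right ?_ (norm_nonneg _)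
    calc ∑ a, ∑ c, |gramInv b (G₁ y₀) q a| * |gramInv b (G₂ y₀) c p| * ‖b a‖ * ‖b c‖
        ≤ ∑ a, ∑ c, R * R * ‖b a‖ * ‖b c‖ := by
          refine Finset.sum_le_sum fun a _ ↦ Finset.sum_le_sum fun c _ ↦ ?_
          have h1 : |gramInv b (G₁ y₀) q a| * |gramInv b (G₂ y₀) c p| ≤ R * R :=
            mul_le_mul (hGa₁ q a) (hGa₂ c p) (abs_nonneg _) hR0
          exact mul_le_mul_of_nonneg_right (mul_le_mul_of_nonneg_right h1 (norm_nonneg _))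
            (norm_nonneg _)
      _ = R ^ 2 * basisSum b ^ 2 := by
          rw [basisSum, sq (∑ p, ‖b p‖), Finset.sum_mul_sum, Finset.mul_sum]
          refine Finset.sum_congr rfl fun a _ ↦ ?_
          rw [Finset.mul_sum]
          exact Finset.sum_congr rfl fun c _ ↦ by ring
  have hQ₂' : ∀ p q, ‖Q₂ p q‖ ≤ K₅ := by
    intro p q
    have h1 : ‖(fun p q' ↦ fderiv ℝ (fderiv ℝ G₂) y₀ (b p) (b q') :
        ι → ι → (E →L[ℝ] E →L[ℝ] ℝ))‖ ≤ R₃ := hR₃ (y₀, t) hq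
    exact (norm_le_pi_norm _ q).trans ((norm_le_pi_norm
      (fun p q' ↦ fderiv ℝ (fderiv ℝ G₂) y₀ (b p) (b q') : ι → ι → (E →L[ℝ] E →L[ℝ] ℝ)) p).trans h1)
  -- the Hessian of `û` at the maximum
  have htr : ∑ p, ∑ q, Gi₁ q p * Φ p q ≤ 0 :=
    sum_gramInv_fderiv_fderiv_nonpos b (hR₁ t ht) z yT (contDiffAt_wsum b hw hHf2) hmax
  have hR₆' : ∀ i j a c, ‖fderiv ℝ (fun y ↦ w0 y i j a c) y₀‖ ≤ R₆ := by
    intro i j a c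
    have h1 := hR₆ y₀ hy₀
    exact (norm_le_pi_norm _ c).trans ((norm_le_pi_norm _ a).trans ((norm_le_pi_norm _ j).trans
      ((norm_le_pi_norm (fun i j a c ↦ fderiv ℝ (fun y' ↦ w0 y' i j a c) y₀) i).trans h1)))
  have hR₇' : ∀ i j a c, ‖fderiv ℝ (fderiv ℝ (fun y ↦ w0 y i j a c)) y₀‖ ≤ R₇ := by
    intro i j a c
    have h1 := hR₇ y₀ hy₀
    exact (norm_le_pi_norm _ c).trans ((norm_le_pi_norm _ a).trans ((norm_le_pi_norm _ j).trans
      ((norm_le_pi_norm (fun i j a c ↦ fderiv ℝ (fderiv ℝ (fun y' ↦ w0 y' i j a c)) y₀) i).trans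
        h1)))
  obtain ⟨rem, hnine, hrem⟩ := wsum_hessian_decomposition b hw hHf2 hR₆' hR₇'
  have hnine' : ∀ p q, Φ p q = ip (D2H p q) Hv + ip Hv (D2H p q) + ip (dH p) (dH q)
      + ip (dH q) (dH p) + rem p q := hnine
  have hrem' : ∀ p q, |rem p q| ≤ K₂ * ‖Hv‖ ^ 2 + K₁ * ‖Hv‖ * (‖dH p‖ + ‖dH q‖) := hrem
  -- the splitting of `∂ₜH` and the first-order remainder
  set fterm : ℝ := ip (bilinOfCoeffs b fun c i ↦
    chartLower I b k₁ h z t y₀ (b c) (b i) - chartLower I b k₂ h z t y₀ (b c) (b i)) Hv with hfterm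
  have hHdot' : ip Hdot Hv = ip (∑ p, ∑ q, Gi₁ q p • D2H p q) Hv
      + ip (∑ p, ∑ q, (Gi₁ q p - Gi₂ q p) • Q₂ p q) Hv + fterm :=
    normSqCoord_chartDot_eq b hk₁ hk₂ h z ht yT Gi0 Hv
  have hf : |fterm| ≤ K₆ * ‖Hv‖ * (‖Hv‖ + ∑ p, ‖dH p‖) := by
    -- the Lipschitz bound for the lower-order terms
    have hΔ : ∀ c i, |chartLower I b k₁ h z t y₀ (b c) (b i) - chartLower I b k₂ h z t y₀ (b c) (b i)|
        ≤ L * (1 + K₄ + coordSum b) * (‖Hv‖ + ∑ p, ‖dH p‖) := by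
      intro c i
      rw [chartLower_basis_eq, chartLower_basis_eq]
      have h1 := hL c i (G₁ y₀) (G₂ y₀) (fun j i ↦ gramInv b (G₁ y₀) j i)
        (fun j i ↦ gramInv b (G₂ y₀) j i)
        (fderiv ℝ G₁ y₀) (fderiv ℝ G₂ y₀) (fun i j ↦ bgChris I b h z y₀ (b i) (b j))
        (fun p i j ↦ fderiv ℝ (fun y' : E ↦ bgChris I b h z y' (b i) (b j)) y₀ (b p))
        (hdat₁.trans hR₁R) (hdat₂.trans hR₂R)
      refine h1.trans ?_
      -- `‖G₁ - G₂‖ = ‖H‖`, `‖g₁⁻¹ - g₂⁻¹‖ ≤ K₄ ‖H‖`, `‖DG₁ - DG₂‖ ≤ Bc ∑ ‖∂ₚH‖`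
      have e1 : ‖G₁ y₀ - G₂ y₀‖ = ‖Hv‖ := rfl
      have e2 : ‖(fun j i ↦ gramInv b (G₁ y₀) j i) - (fun j i ↦ gramInv b (G₂ y₀) j i)‖ ≤
          K₄ * ‖Hv‖ := by
        refine (pi_norm_le_iff_of_nonneg (by positivity)).2 fun j ↦
          (pi_norm_le_iff_of_nonneg (by positivity)).2 fun i ↦ ?_
        rw [Pi.sub_apply, Pi.sub_apply, Real.norm_eq_abs]
        exact hGi i j
      have e3 : ‖fderiv ℝ G₁ y₀ - fderiv ℝ G₂ y₀‖ ≤ coordSum b * ∑ p, ‖dH p‖ := by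
        rw [← hDH]
        refine (opNorm_le_sum_basis b (fderiv ℝ Hf y₀)).trans ?_
        rw [Finset.mul_sum]
        refine Finset.sum_le_sum fun p _ ↦ ?_
        exact mul_le_mul_of_nonneg_right (norm_coord_le b p) (norm_nonneg _)
      have hsum0 : 0 ≤ ∑ p, ‖dH p‖ := Finset.sum_nonneg fun p _ ↦ norm_nonneg _
      have hHv0 : 0 ≤ ‖Hv‖ := norm_nonneg _
      calc L * (‖G₁ y₀ - G₂ y₀‖
            + ‖(fun j i ↦ gramInv b (G₁ y₀) j i) - (fun j i ↦ gramInv b (G₂ y₀) j i)‖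
            + ‖fderiv ℝ G₁ y₀ - fderiv ℝ G₂ y₀‖)
          ≤ L * (‖Hv‖ + K₄ * ‖Hv‖ + coordSum b * ∑ p, ‖dH p‖) := by
            rw [e1]
            exact mul_le_mul_of_nonneg_left (by linarith) hL0
        _ ≤ L * (1 + K₄ + coordSum b) * (‖Hv‖ + ∑ p, ‖dH p‖) := by
            have : ‖Hv‖ + K₄ * ‖Hv‖ + coordSum b * ∑ p, ‖dH p‖ ≤
                (1 + K₄ + coordSum b) * (‖Hv‖ + ∑ p, ‖dH p‖) := by
              have ex : (1 + K₄ + coordSum b) * (‖Hv‖ + ∑ p, ‖dH p‖) =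
                  (‖Hv‖ + K₄ * ‖Hv‖ + coordSum b * ∑ p, ‖dH p‖)
                    + ((∑ p, ‖dH p‖) + K₄ * (∑ p, ‖dH p‖) + coordSum b * ‖Hv‖) := by ring
              rw [ex]
              have m1 := mul_nonneg hK₄0 hsum0
              have m2 := mul_nonneg hBc0 hHv0
              linarith
            calc L * (‖Hv‖ + K₄ * ‖Hv‖ + coordSum b * ∑ p, ‖dH p‖)
                ≤ L * ((1 + K₄ + coordSum b) * (‖Hv‖ + ∑ p, ‖dH p‖)) :=
                  mul_le_mul_of_nonneg_left this hL0
              _ = L * (1 + K₄ + coordSum b) * (‖Hv‖ + ∑ p, ‖dH p‖) := by ring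
    have hK₀' : normSqCoordBound b Gi0 ≤ K₀ := by
      rw [normSqCoordBound_eq_wsumBound, hK₀]
      refine wsumBound_le_of_forall_abs_le b fun i j a c ↦ ?_
      rw [abs_mul, sq]
      exact mul_le_mul (hGi0e j i) (hGi0e c a) (abs_nonneg _) hR₅0
    have h1 := abs_normSqCoord_bilinOfCoeffs_le b Gi0 hΔ hK₀' Hv
    refine h1.trans (le_of_eq ?_)
    rw [hK₆]
    ring
  -- ### conclusion
  have key := JetEstimate.two_mul_ip_le hip' hμ hlam hK₀0 hK₂0 hR0 hK₄0 hK₅0 hK₆0 hcoer' hbd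
    hsym hell' hGi₁ hGi hQ₂' htr hnine' hrem' hHdot' hf
  exact key

end MaxPoint

end Literature.Geometry.Riemannian

end
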